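import Summits.Ventures.PercRepro.NullityCircuits
import Summits.Ventures.PercRepro.RankLevelSetCountBounds

/-!
# PercRepro — the circuits of size `≤ k` of a matroid of nullity `d` (night-1, gen 0)

`proofs/NIGHT-1-C025-induction.md` §10, Corollary N′ in set form, for the finite case:

* `circuitsLE M k` — the circuits with at most `k` elements; `circuitsLE_finite`;
* `listUnion_eq_sUnion` — the union of a list is the union of its members;
* **`encard_sUnion_circuitsLE_le`** — the union `S` of all circuits of size `≤ k` satisfies `|S| ≤ k · d` when
  `|E| = r(E) + d` (Corollary N′ + nullity monotonicity);
* **`ncard_circuitsLE_le`** — hence there are at most `2^{k·d}` circuits of size `≤ k` (they are subsets of `S`).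
Axioms: standard.
-/

namespace PercRepro

namespace Matroid

open Set

variable {α : Type*} {M : _root_.Matroid α}

/-- The circuits of `M` with at most `k` elements. -/
def circuitsLE (M : _root_.Matroid α) (k : ℕ) : Set (Set α) :=
  {C : Set α | M.IsCircuit C ∧ C.encard ≤ k}

/-- Members of `circuitsLE` are subsets of the ground set. -/
theorem subset_ground_of_mem_circuitsLE {k : ℕ} {C : Set α} (hC : C ∈ circuitsLE M k) : C ⊆ M.E :=
  hC.1.subset_ground

/-- `circuitsLE M k` is finite for a finite matroid. -/
theorem circuitsLE_finite [M.Finite] (k : ℕ) : (circuitsLE M k).Finite :=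
  M.ground_finite.finite_subsets.subset (fun _ hC => subset_ground_of_mem_circuitsLE hC)

/-- The union of a list is the union of the sets in it. -/
theorem listUnion_eq_sUnion (L : List (Set α)) : listUnion L = ⋃₀ {C | C ∈ L} := by
  induction L with
  | nil => simp [listUnion]
  | cons C L ih =>
    simp only [listUnion, ih]
    ext x
    simp only [Set.mem_union, Set.mem_sUnion, Set.mem_setOf_eq, List.mem_cons]
    constructor
    · rintro (⟨D, hD, hx⟩ | hx)
      · exact ⟨D, Or.inr hD, hx⟩
      · exact ⟨C, Or.inl rfl, hx⟩
    · rintro ⟨D, (rfl | hD), hx⟩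
      · exact Or.inr hx
      · exact Or.inl ⟨D, hD, hx⟩

/-- **Corollary N′ in set form**: if `|E| = r(E) + d`, the union `S` of all circuits with at most `k` elements has at
most `k · d` elements. -/
theorem encard_sUnion_circuitsLE_le [M.Finite] {k d : ℕ} (hd : M.E.encard = M.eRank + d) :
    (⋃₀ circuitsLE M k).encard ≤ k * d := by
  classical
  have hfin := circuitsLE_finite (M := M) k
  -- enumerate the circuits in a list
  set L := hfin.toFinset.toList with hL
  have hmem : ∀ C, C ∈ L ↔ C ∈ circuitsLE M k := by
    intro C
    rw [hL, Finset.mem_toList, Set.Finite.mem_toFinset]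
  have hS : ⋃₀ circuitsLE M k = listUnion L := by
    rw [listUnion_eq_sUnion]
    congr 1
    ext C
    exact (hmem C).symm
  set S := ⋃₀ circuitsLE M k with hSdef
  have hSE : S ⊆ M.E := by
    intro x hx
    obtain ⟨C, hC, hxC⟩ := Set.mem_sUnion.1 hx
    exact subset_ground_of_mem_circuitsLE hC hxC
  have hSfin : S.Finite := M.ground_finite.subset hSE
  -- Corollary N′ on the list
  have hN := encard_listUnion_add_le (M := M) k L
    (fun C hC => (hmem C).1 hC) (fun C hC => M.ground_finite.subset (subset_ground_of_mem_circuitsLE ((hmem C).1 hC)))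
  rw [← hS] at hN
  -- nullity monotonicity: `|S| + r(E) ≤ |E| + r(S) = r(E) + d + r(S)`
  have hmono := encard_add_eRank_le hSE
  rw [hd] at hmono
  have hR : M.eRank ≠ ⊤ := (_root_.Matroid.eRank_ne_top_iff M).2 inferInstance
  have hrS : M.eRk S ≠ ⊤ := ((M.eRk_le_encard S).trans_lt hSfin.encard_lt_top).ne
  -- from `hN`: `|S| + k r(S) ≤ k |S|`; from `hmono`: `|S| ≤ d + r(S)` (cancel `r(E)`)
  have h1 : S.encard ≤ d + M.eRk S := by
    have : S.encard + M.eRank ≤ (d + M.eRk S) + M.eRank := by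
      calc S.encard + M.eRank ≤ M.eRank + d + M.eRk S := hmono
        _ = (d + M.eRk S) + M.eRank := by ring
    exact (WithTop.add_le_add_iff_right hR).1 this
  -- `k |S| ≤ k d + k r(S)` and `|S| + k r(S) ≤ k |S|` give `|S| + k r(S) ≤ k d + k r(S)`, cancel `k r(S)`
  have h2 : (k : ℕ∞) * S.encard ≤ k * d + k * M.eRk S := by
    calc (k : ℕ∞) * S.encard ≤ k * (d + M.eRk S) := by gcongr
      _ = k * d + k * M.eRk S := by ring
  have h3 : S.encard + k * M.eRk S ≤ k * d + k * M.eRk S := hN.trans h2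
  have hkr : (k : ℕ∞) * M.eRk S ≠ ⊤ := WithTop.mul_ne_top (WithTop.natCast_ne_top k) hrS
  have h4 : S.encard ≤ (k : ℕ∞) * d := (WithTop.add_le_add_iff_right hkr).1 h3
  exact_mod_cast h4

/-- **At most `2^{k·d}` circuits of size `≤ k`** in a finite matroid with `|E| = r(E) + d`. -/
theorem ncard_circuitsLE_le [M.Finite] {k d : ℕ} (hd : M.E.encard = M.eRank + d) :
    (circuitsLE M k).ncard ≤ 2 ^ (k * d) := by
  classical
  set S := ⋃₀ circuitsLE M k with hSdef
  have hSE : S ⊆ M.E := by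
    intro x hx
    obtain ⟨C, hC, hxC⟩ := Set.mem_sUnion.1 hx
    exact subset_ground_of_mem_circuitsLE hC hxC
  have hSfin : S.Finite := M.ground_finite.subset hSE
  have hSsize : S.ncard ≤ k * d := by
    have := encard_sUnion_circuitsLE_le (M := M) (k := k) hd
    rw [← hSfin.cast_ncard_eq] at this
    exact_mod_cast this
  -- every small circuit is a subset of `S`
  have hsub : circuitsLE M k ⊆ {X : Set α | X ⊆ (hSfin.toFinset : Set α) ∧ X.ncard ≤ S.ncard} := by
    intro C hC
    have hCS : C ⊆ S := Set.subset_sUnion_of_mem hC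
    refine ⟨by rw [Set.Finite.coe_toFinset]; exact hCS, Set.ncard_le_ncard hCS hSfin⟩
  calc (circuitsLE M k).ncard
      ≤ {X : Set α | X ⊆ (hSfin.toFinset : Set α) ∧ X.ncard ≤ S.ncard}.ncard :=
        Set.ncard_le_ncard hsub ((hSfin.toFinset.finite_toSet.finite_subsets).subset (fun X hX => hX.1))
    _ ≤ ∑ j ∈ Finset.range (S.ncard + 1), hSfin.toFinset.card.choose j := ncard_subsets_ncard_le _ _
    _ = 2 ^ hSfin.toFinset.card := by
        rw [Set.ncard_eq_toFinset_card S hSfin, Nat.sum_range_choose]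
    _ ≤ 2 ^ (k * d) := by
        apply Nat.pow_le_pow_right (by norm_num)
        rw [← Set.ncard_eq_toFinset_card S hSfin]
        exact hSsize

end Matroid

end PercRepro
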